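import Mathlib
import Summits.Ventures.PercRepro2.V2ParallelClosure
import Summits.Ventures.PercRepro2.V2SP
import Summits.Ventures.PercRepro2.HallOffFrame
import Summits.Ventures.PercRepro2.HallOffAxis
import Summits.Ventures.PercRepro2.Tail2DRowOne

/-!
# The Hall (monotone-relay) form of the row `j = 1` reduces to its first two members
(seat mine-b, cell pub-perc-repro2; MINE-B.md §37)

`HallFn (phi a 1) r b` says that every upper set `U` of the configuration poset (red < blue on the free
edges) satisfies `#(U ∩ {r = a−1, b ≥ 2}) ≥ #(U ∩ {r ≥ a, b = 1})` — by Hall's theorem, an injection from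
`{r ≥ a, b = 1}` into `{r = a−1, b ≥ 2}` that only recolours red edges blue; the upper set `univ` is the
count `T(a,1) ≤ T(a−1,2)` of `Tail2DRowOne.lean` (`t_row1`).

The pointwise certificate `Tail2D.phi_row_par_ge` of the counting parallel step is of the fibre form
(hypothesis of one factor) × (non-negative weight of the other), so it proves the PARALLEL STEP OF THE
HALL FORM as well (`hallFn_phi_row_par`, the fibre lemmas of `HallOffFrame.lean`): for `a ≥ 4`, if the
row weights `phi m 1`, `2 ≤ m ≤ a`, and the axis weights `phi (a−1) 0`, `phi a 0` are Hall on both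
factors, then `phi a 1` is Hall on the parallel composition.  With `hallFn_phi_ser` (series) and the atoms,
the Hall form of the WHOLE row `j = 1` on every series–parallel pattern follows from its members `(2,1)`
and `(3,1)` (`SP.hallFn_phi_row_of`) — the two members for which the fibre method has no certificate
(registry §36.3, §36.7): the monotone-relay form of the row reduces to its two smallest cases.
-/

namespace Summit.Ventures.PercRepro2.V2Closure

open Finset

variable {X Y : Type*}

/-- The first term of the row certificate, as a sum over `k ≤ a − 3` of (Hall weight of `x`) × (weight of `y`). -/
theorem row_first_term_eq (a r b r' b' : ℕ) :
    (if b' = 0 ∧ r' + 3 ≤ a then (1 : ℤ) else 0) * phi (a - r') 1 r b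
      = ∑ k ∈ Finset.range (a - 2), phi (a - k) 1 r b * (if r' = k ∧ b' = 0 then (1 : ℤ) else 0) := by
  by_cases h : b' = 0 ∧ r' + 3 ≤ a
  · rw [if_pos h, one_mul]
    rw [Finset.sum_eq_single r']
    · simp [h.1]
    · intro k _ hk
      simp [Ne.symm hk]
    · intro hr
      exfalso; apply hr
      simp only [Finset.mem_range]; omega
  · rw [if_neg h, zero_mul]
    symm
    apply Finset.sum_eq_zero
    intro k hk
    simp only [Finset.mem_range] at hk
    split_ifs with h2
    · exfalso; apply h; constructor <;> omega
    · simp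

/-- **The parallel step of the Hall form of the row `j = 1`** (`a ≥ 4`): the row weights `phi m 1`,
`2 ≤ m ≤ a`, and the axis weights `phi (a−1) 0`, `phi a 0` Hall on both factors ⟹ `phi a 1` Hall on the
parallel composition (sums of the labels). -/
theorem hallFn_phi_row_par [Preorder X] [Preorder Y] [Fintype X] [Fintype Y] [DecidableEq X] [DecidableEq Y]
    (a : ℕ) (ha : 4 ≤ a) (r b : X → ℕ) (r' b' : Y → ℕ)
    (hX1 : ∀ m, 2 ≤ m → m ≤ a → HallFn (phi m 1) r b) (hY1 : ∀ m, 2 ≤ m → m ≤ a → HallFn (phi m 1) r' b')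
    (hX0 : ∀ m, a - 1 ≤ m → m ≤ a → HallFn (phi m 0) r b)
    (hY0 : ∀ m, a - 1 ≤ m → m ≤ a → HallFn (phi m 0) r' b') :
    HallFn (phi a 1) (parR r r') (parB b b') := by
  intro W hW
  -- the eight terms of the certificate, summed over `W`
  have key : ∀ p : X × Y,
      (∑ k ∈ Finset.range (a - 2), phi (a - k) 1 (r p.1) (b p.1) * (if r' p.2 = k ∧ b' p.2 = 0 then (1 : ℤ) else 0))
      + (if b p.1 = 0 ∧ r p.1 + 3 ≤ a then (1 : ℤ) else 0) * phi (a - r p.1) 1 (r' p.2) (b' p.2)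
      + phi 2 1 (r p.1) (b p.1) * (if b' p.2 = 0 ∧ a ≤ r' p.2 + 2 then (1 : ℤ) else 0)
      + (if b p.1 = 0 ∧ a ≤ r p.1 + 2 then (1 : ℤ) else 0) * phi 2 1 (r' p.2) (b' p.2)
      + phi a 0 (r p.1) (b p.1) * (if r' p.2 = 0 ∧ 1 ≤ b' p.2 then (1 : ℤ) else 0)
      + phi (a - 1) 0 (r p.1) (b p.1) * (if r' p.2 = 1 ∧ 1 ≤ b' p.2 then (1 : ℤ) else 0)
      + (if r p.1 = 0 ∧ 1 ≤ b p.1 then (1 : ℤ) else 0) * phi a 0 (r' p.2) (b' p.2)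
      + (if r p.1 = 1 ∧ 1 ≤ b p.1 then (1 : ℤ) else 0) * phi (a - 1) 0 (r' p.2) (b' p.2)
      ≤ phi a 1 (parR r r' p) (parB b b' p) := by
    intro p
    have h := Tail2D.phi_row_par_ge a (r p.1) (b p.1) (r' p.2) (b' p.2) ha
    rw [row_first_term_eq] at h
    unfold parR parB
    linarith [h, mul_comm (if b' p.2 = 0 ∧ a ≤ r' p.2 + 2 then (1 : ℤ) else 0) (phi 2 1 (r p.1) (b p.1)),
      mul_comm (if r' p.2 = 0 ∧ 1 ≤ b' p.2 then (1 : ℤ) else 0) (phi a 0 (r p.1) (b p.1)),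
      mul_comm (if r' p.2 = 1 ∧ 1 ≤ b' p.2 then (1 : ℤ) else 0) (phi (a - 1) 0 (r p.1) (b p.1))]
  -- the mirror first term, as a sum over `k`
  have key2 : ∀ p : X × Y,
      (if b p.1 = 0 ∧ r p.1 + 3 ≤ a then (1 : ℤ) else 0) * phi (a - r p.1) 1 (r' p.2) (b' p.2)
        = ∑ k ∈ Finset.range (a - 2), (if r p.1 = k ∧ b p.1 = 0 then (1 : ℤ) else 0) * phi (a - k) 1 (r' p.2) (b' p.2) := by
    intro p
    rw [row_first_term_eq]
    refine Finset.sum_congr rfl (fun k _ => ?_)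
    ring
  calc (0 : ℤ) ≤ _ := ?_
    _ ≤ ∑ p ∈ W, phi a 1 (parR r r' p) (parB b b' p) := Finset.sum_le_sum (fun p _ => key p)
  simp only [key2, Finset.sum_add_distrib]
  refine add_nonneg (add_nonneg (add_nonneg (add_nonneg (add_nonneg (add_nonneg (add_nonneg ?_ ?_) ?_) ?_) ?_) ?_) ?_) ?_
  · rw [Finset.sum_comm]
    refine Finset.sum_nonneg (fun k hk => ?_)
    simp only [Finset.mem_range] at hk
    exact sum_hall_mul_nonneg_fst (hX1 (a - k) (by omega) (by omega)) r' b'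
      (fun u v => if u = k ∧ v = 0 then 1 else 0) (fun u v => by split_ifs <;> simp) W hW
  · rw [Finset.sum_comm]
    refine Finset.sum_nonneg (fun k hk => ?_)
    simp only [Finset.mem_range] at hk
    exact sum_mul_hall_nonneg_snd r b (hY1 (a - k) (by omega) (by omega))
      (fun u v => if u = k ∧ v = 0 then 1 else 0) (fun u v => by split_ifs <;> simp) W hW
  · exact sum_hall_mul_nonneg_fst (hX1 2 le_rfl (by omega)) r' b'
      (fun u v => if v = 0 ∧ a ≤ u + 2 then 1 else 0) (fun u v => by split_ifs <;> simp) W hW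
  · exact sum_mul_hall_nonneg_snd r b (hY1 2 le_rfl (by omega))
      (fun u v => if v = 0 ∧ a ≤ u + 2 then 1 else 0) (fun u v => by split_ifs <;> simp) W hW
  · exact sum_hall_mul_nonneg_fst (hX0 a (by omega) le_rfl) r' b'
      (fun u v => if u = 0 ∧ 1 ≤ v then 1 else 0) (fun u v => by split_ifs <;> simp) W hW
  · exact sum_hall_mul_nonneg_fst (hX0 (a - 1) le_rfl (by omega)) r' b'
      (fun u v => if u = 1 ∧ 1 ≤ v then 1 else 0) (fun u v => by split_ifs <;> simp) W hW
  · exact sum_mul_hall_nonneg_snd r b (hY0 a (by omega) le_rfl)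
      (fun u v => if u = 0 ∧ 1 ≤ v then 1 else 0) (fun u v => by split_ifs <;> simp) W hW
  · exact sum_mul_hall_nonneg_snd r b (hY0 (a - 1) le_rfl (by omega))
      (fun u v => if u = 1 ∧ 1 ≤ v then 1 else 0) (fun u v => by split_ifs <;> simp) W hW

/-- a non-negative weight of `Y` times a function of `X` with non-negative sum wherever the weight is
non-zero: non-negative sum over the product -/
theorem sum_prod_wt_fst' [Fintype X] [Fintype Y] (w : Y → ℤ) (hw : ∀ y, 0 ≤ w y) (h : Y → X → ℤ)
    (hh : ∀ y, w y ≠ 0 → 0 ≤ ∑ x, h y x) :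
    0 ≤ ∑ p : X × Y, w p.2 * h p.2 p.1 := by
  rw [Fintype.sum_prod_type_right]
  refine Finset.sum_nonneg (fun y _ => ?_)
  have e := Finset.mul_sum (Finset.univ : Finset X) (fun x => h y x) (w y)
  dsimp only
  rw [← e]
  by_cases hy : w y = 0
  · rw [hy]; simp
  · exact mul_nonneg (hw y) (hh y hy)

/-- the mirror statement (weight of `X`, function of `Y`) -/
theorem sum_prod_wt_snd' [Fintype X] [Fintype Y] (w : X → ℤ) (hw : ∀ x, 0 ≤ w x) (h : X → Y → ℤ)
    (hh : ∀ x, w x ≠ 0 → 0 ≤ ∑ y, h x y) :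
    0 ≤ ∑ p : X × Y, w p.1 * h p.1 p.2 := by
  rw [Fintype.sum_prod_type]
  refine Finset.sum_nonneg (fun x _ => ?_)
  have e := Finset.mul_sum (Finset.univ : Finset Y) (fun y => h x y) (w x)
  dsimp only
  rw [← e]
  by_cases hx : w x = 0
  · rw [hx]; simp
  · exact mul_nonneg (hw x) (hh x hx)

/-- **The counting parallel step of the row `j = 1` for arbitrary labelled finite types** (`a ≥ 4`): if the
counts of `phi m 1` (`3 ≤ m ≤ a`) are non-negative, the count of `phi 2 1` is non-negative, and the counts of
the axis weights `phi (a−1) 0`, `phi a 0` are non-negative on both factors, then the count of `phi a 1` is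
non-negative on the sums of the labels — the class of two-dimensional laws with the axis family, the row
`j = 1` and the sign of the level `2` is closed under convolution. -/
theorem sum_phi_row_par' [Fintype X] [Fintype Y] (a : ℕ) (ha : 4 ≤ a) (r b : X → ℕ) (r' b' : Y → ℕ)
    (hX1 : ∀ m, 3 ≤ m → m ≤ a → 0 ≤ ∑ x, phi m 1 (r x) (b x))
    (hY1 : ∀ m, 3 ≤ m → m ≤ a → 0 ≤ ∑ y, phi m 1 (r' y) (b' y))
    (hX2 : 0 ≤ ∑ x, phi 2 1 (r x) (b x)) (hY2 : 0 ≤ ∑ y, phi 2 1 (r' y) (b' y))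
    (hX0 : ∀ m, a - 1 ≤ m → m ≤ a → 0 ≤ ∑ x, phi m 0 (r x) (b x))
    (hY0 : ∀ m, a - 1 ≤ m → m ≤ a → 0 ≤ ∑ y, phi m 0 (r' y) (b' y)) :
    0 ≤ ∑ p : X × Y, phi a 1 (parR r r' p) (parB b b' p) := by
  have h1 := sum_prod_wt_fst' (X := X) (fun y => if b' y = 0 ∧ r' y + 3 ≤ a then (1 : ℤ) else 0)
    (fun y => by split_ifs <;> simp) (fun y x => phi (a - r' y) 1 (r x) (b x))
    (fun y hy => by
      split_ifs at hy with h
      · exact hX1 (a - r' y) (by omega) (by omega)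
      · exact absurd rfl hy)
  have h2 := sum_prod_wt_snd' (Y := Y) (fun x => if b x = 0 ∧ r x + 3 ≤ a then (1 : ℤ) else 0)
    (fun x => by split_ifs <;> simp) (fun x y => phi (a - r x) 1 (r' y) (b' y))
    (fun x hx => by
      split_ifs at hx with h
      · exact hY1 (a - r x) (by omega) (by omega)
      · exact absurd rfl hx)
  have h3 := sum_prod_wt_fst' (X := X) (fun y => if b' y = 0 ∧ a ≤ r' y + 2 then (1 : ℤ) else 0)
    (fun y => by split_ifs <;> simp) (fun _ x => phi 2 1 (r x) (b x)) (fun _ _ => hX2)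
  have h4 := sum_prod_wt_snd' (Y := Y) (fun x => if b x = 0 ∧ a ≤ r x + 2 then (1 : ℤ) else 0)
    (fun x => by split_ifs <;> simp) (fun _ y => phi 2 1 (r' y) (b' y)) (fun _ _ => hY2)
  have h5 := sum_prod_wt_fst' (X := X) (fun y => if r' y = 0 ∧ 1 ≤ b' y then (1 : ℤ) else 0)
    (fun y => by split_ifs <;> simp) (fun _ x => phi a 0 (r x) (b x)) (fun _ _ => hX0 a (by omega) le_rfl)
  have h6 := sum_prod_wt_fst' (X := X) (fun y => if r' y = 1 ∧ 1 ≤ b' y then (1 : ℤ) else 0)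
    (fun y => by split_ifs <;> simp) (fun _ x => phi (a - 1) 0 (r x) (b x)) (fun _ _ => hX0 (a - 1) le_rfl (by omega))
  have h7 := sum_prod_wt_snd' (Y := Y) (fun x => if r x = 0 ∧ 1 ≤ b x then (1 : ℤ) else 0)
    (fun x => by split_ifs <;> simp) (fun _ y => phi a 0 (r' y) (b' y)) (fun _ _ => hY0 a (by omega) le_rfl)
  have h8 := sum_prod_wt_snd' (Y := Y) (fun x => if r x = 1 ∧ 1 ≤ b x then (1 : ℤ) else 0)
    (fun x => by split_ifs <;> simp) (fun _ y => phi (a - 1) 0 (r' y) (b' y)) (fun _ _ => hY0 (a - 1) le_rfl (by omega))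
  have key : ∀ p : X × Y,
      (if b' p.2 = 0 ∧ r' p.2 + 3 ≤ a then (1 : ℤ) else 0) * phi (a - r' p.2) 1 (r p.1) (b p.1)
      + (if b p.1 = 0 ∧ r p.1 + 3 ≤ a then (1 : ℤ) else 0) * phi (a - r p.1) 1 (r' p.2) (b' p.2)
      + (if b' p.2 = 0 ∧ a ≤ r' p.2 + 2 then (1 : ℤ) else 0) * phi 2 1 (r p.1) (b p.1)
      + (if b p.1 = 0 ∧ a ≤ r p.1 + 2 then (1 : ℤ) else 0) * phi 2 1 (r' p.2) (b' p.2)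
      + (if r' p.2 = 0 ∧ 1 ≤ b' p.2 then (1 : ℤ) else 0) * phi a 0 (r p.1) (b p.1)
      + (if r' p.2 = 1 ∧ 1 ≤ b' p.2 then (1 : ℤ) else 0) * phi (a - 1) 0 (r p.1) (b p.1)
      + (if r p.1 = 0 ∧ 1 ≤ b p.1 then (1 : ℤ) else 0) * phi a 0 (r' p.2) (b' p.2)
      + (if r p.1 = 1 ∧ 1 ≤ b p.1 then (1 : ℤ) else 0) * phi (a - 1) 0 (r' p.2) (b' p.2)
      ≤ phi a 1 (parR r r' p) (parB b b' p) :=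
    fun p => Tail2D.phi_row_par_ge a (r p.1) (b p.1) (r' p.2) (b' p.2) ha
  calc (0 : ℤ) ≤ _ := add_nonneg (add_nonneg (add_nonneg (add_nonneg (add_nonneg (add_nonneg (add_nonneg h1 h2) h3) h4) h5) h6) h7) h8
    _ = ∑ p : X × Y, (_ + _ + _ + _ + _ + _ + _ + _) := by simp only [Finset.sum_add_distrib]
    _ ≤ ∑ p : X × Y, phi a 1 (parR r r' p) (parB b b' p) := Finset.sum_le_sum (fun p _ => key p)

/-- **The Hall form of the whole row `j = 1` reduces to its members `(2,1)` and `(3,1)`**: if `phi 2 1` and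
`phi 3 1` are Hall on every series–parallel pattern, so is `phi a 1` for every `a ≥ 2`. -/
theorem SP.hallFn_phi_row_of (h2 : ∀ s : SP, HallFn (phi 2 1) s.rLab s.bLab)
    (h3 : ∀ s : SP, HallFn (phi 3 1) s.rLab s.bLab) :
    ∀ (s : SP) (a : ℕ), 2 ≤ a → HallFn (phi a 1) s.rLab s.bLab
  | .free, a, ha => Atoms.hallFn_phi_free a 1 ha
  | .pin, a, ha => Atoms.hallFn_phi_pin a 1 ha
  | .absent, a, ha => Atoms.hallFn_phi_absent a 1 ha
  | .ser s t, a, ha => hallFn_phi_ser a 1 s.rLab s.bLab t.rLab t.bLab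
      (SP.hallFn_phi_row_of h2 h3 s a ha) (SP.hallFn_phi_row_of h2 h3 t a ha)
  | .par s t, a, ha => by
    rcases (by omega : a = 2 ∨ a = 3 ∨ 4 ≤ a) with h | h | h
    · subst h; exact h2 (.par s t)
    · subst h; exact h3 (.par s t)
    · exact hallFn_phi_row_par a h s.rLab s.bLab t.rLab t.bLab
        (fun m hm _ => SP.hallFn_phi_row_of h2 h3 s m hm) (fun m hm _ => SP.hallFn_phi_row_of h2 h3 t m hm)
        (fun m hm _ => SP.hallFn_phi_axis s m (by omega)) (fun m hm _ => SP.hallFn_phi_axis t m (by omega))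

/-- The reading on upper sets: under the two hypotheses, for every pattern, every `a ≥ 2` and every upper
set `U` of the configuration poset, `U` contains at least as many configurations with `r = a−1, b ≥ 2` as
with `r ≥ a, b = 1` (for a principal upper set `U = ↑c`: the configurations above `c`). -/
theorem SP.row_upper_of (h2 : ∀ s : SP, HallFn (phi 2 1) s.rLab s.bLab)
    (h3 : ∀ s : SP, HallFn (phi 3 1) s.rLab s.bLab) (s : SP) (a : ℕ) (ha : 2 ≤ a)
    (U : Finset s.Conf) (hU : IsUpperSet (↑U : Set s.Conf)) :
    (U.filter (fun y : s.Conf => a ≤ s.rLab y ∧ s.bLab y = 1)).card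
      ≤ (U.filter (fun y : s.Conf => s.rLab y + 1 = a ∧ 2 ≤ s.bLab y)).card := by
  have h := SP.hallFn_phi_row_of h2 h3 s a ha U hU
  have e : ∑ y ∈ U, phi a 1 (s.rLab y) (s.bLab y)
      = ((U.filter (fun y : s.Conf => s.rLab y + 1 = a ∧ 2 ≤ s.bLab y)).card : ℤ)
        - ((U.filter (fun y : s.Conf => a ≤ s.rLab y ∧ s.bLab y = 1)).card : ℤ) := by
    rw [Finset.card_filter, Finset.card_filter]
    push_cast
    rw [← Finset.sum_sub_distrib]
    refine Finset.sum_congr rfl (fun y _ => ?_)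
    unfold phi
    split_ifs <;> omega
  rw [e] at h
  omega

end Summit.Ventures.PercRepro2.V2Closure
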